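/-
Copyright (c) 2026 the pub-hodgecm-mathlib formalisation cell (harness21).  Prover seat hodgecm-mathlib-LH4-p05 (g4), req620 Track A «(D-RAM) FOUR-FRAME» squad F0∕P3c∕LH4,
unit (ii-H), leaf (ρ2b′-X): organ S2′ «THE THIRD-FIELD PACKAGE» at type U (dealer LH4-plan (g12) WORD #28; payer LH4-p14 (g4) socket `SOCKET-hLM.v1`; consumer ★ T5a
`F0P3cDyRamToricLevelCensusUnr` (LH4-p08 (g4)), adapters LH4-p07 (g7)).  2026-09-04.
-/
import Literature.NumberTheory.LocalFields.UnramifiedQuadraticNormSurjective            -- ★ Serre V §2 `exists_mul_map_eq_of_finite_residueField`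
import Literature.NumberTheory.LocalFields.ValuedCompleteIsAdicComplete                 -- ★ `isAdicComplete_valuedInteger_of_completeSpace`
import Literature.NumberTheory.Automorphic.SymplecticGroupCartanUnique                  -- ★ `CartanUnique.isDiscreteValuationRing_integer`
import HarnessLib

/-!
# Crux `H413`, line LH4 «(D-RAM) FOUR-FRAME» — unit (ii-H), leaf (ρ2b′-X): S2′ THE THIRD-FIELD PACKAGE AT TYPE U — the third field `K♮ = Fix Θ` of the
# four-involution frame AS A VALUED FIELD, with every `K'`-binder of ★ T5a `ncard_levelSet_unr_hyper`

Cell `hodgecm-mathlib` (D-0151), FLOOR 0, crux item H413 = `stmt-HodgeConjecture-24833`, route of record `HCCMUnconditional`; squad F0∕P3c∕LH4.  THEOREMS ONLY (no `def`,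
no instance, no notation, no named fact, no `sorry`, default heartbeats); lane `--supports stmt-HodgeConjecture-24833 --as helper` (count-neutral).

THE SOCKET SERVED.  The payer's line-model census (`SOCKET-hLM.v1`, ★ p857694 `frameCensus_of_lineModelCensus`) holds, at every `G`-regular type-(2) `γ_H`, the
eigen-package of ★ p857432 `exists_eigenPackage` in ONE-FIELD CURRENCY: `K := M = E′_{w₁}` (an `adicCompletion`: complete, DVR integers, finite residue field),
`ρ := c_{w₁}` and an ABSTRACT adjoint involution `Θ : M →+* M` (four clauses), the integral generator `α`, the `ρ`-fixed uniformiser `ϖE = ι(ϖ)`.  The toric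
census rows ★ T5a (`ncard_levelSet_unr_hyper`, `…_aniso`, the `levelSetDep` rows) consume IN ADDITION a third field `K'` — a valued field in its own right with
`[IsDiscreteValuationRing 𝒪[K']] [Finite 𝓀[K']]`, an involution `σ'`, a uniformiser `π'` of `σ'`-depth `d`, residue field of size `q`, and an isometric
embedding `jK : K' →+* M` onto `Fix Θ` intertwining `σ'` with `ρ` — and the unit-norm surjectivity `hnorm` of `M ∕ K♮`.  Because `Θ` is abstract and the
global quadratic field `E′ = L(√m₀)` (`m₀ ∈ L`) is universally quantified in the socket, `Fix Θ` has NO global model there: this file builds `K'` LOCALLY.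

WHAT IS PROVED (one-field currency throughout; `ρ, Θ` commuting isometric involutions of a `ℤᵐ⁰`-valued field `K`).
* §1 `exists_aux_unit` — from `|α| ≤ 1`, `|α − ρα| = 1`, `|ρα − Θα| < 1` an `α' ∈ {α, α + 1}` with moreover `|α' + ρα'| = 1`;
  `v_add_map_lt_of_fixed` — `|P + ΘP| < |P|` for a `ρ`-fixed uniformiser `P` when doubly-fixed elements have even order;
  **`exists_fixed_uniformizer`** — `π := (P·Θα' + ΘP·α')∕(α' + Θα')` is a `Θ`-FIXED UNIFORMISER with `|π − ρπ| = |P − ΘP| = |π|^d`: the third field has the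
  SAME different exponent as `E = Fix ρ` — an explicit, characteristic-free two-line computation (`π − ρπ = (ΘP − P)·ν∕(T·ρT)` with the unit
  `ν = α'·ρΘα' − ρα'·Θα' ≡ (α' − ρα')(α' + ρα')`), replacing the conductor–discriminant argument for the biquadratic `M ⊃ E, K♮, U`.
* §2 `exists_unit_mul_map_eq` — a `Θ`-fixed unit is `ω·Θω` for a unit `ω` (★ Serre V §2 `exists_mul_map_eq_of_finite_residueField` on `𝒪[K]`, `𝓂`-adically
  complete by ★ `isAdicComplete_valuedInteger_of_completeSpace`; the moving integer is `α'`, `|Θα' − α'| = 1`).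
* §3 `finite_and_natCard_residueField_eq_sq` — for ANY valued `K'` embedded isometrically onto `Fix Θ`: `𝓀[K']` is finite and `#𝓀[K] = #𝓀[K']²` (the
  integral basis `z = x + y·α`, `y = (z − Θz)∕(α − Θα)` of `𝒪_M` over `𝒪_{K♮}`; bijection `𝓀[K'] × 𝓀[K'] → 𝓀[K]`, `(a, b) ↦ a + b·ᾱ`).
* §4 **`exists_thirdFieldPackage_unr`** — THE PACKAGE: `∃ (K' : Type) (_ : Field K') (_ : Valued K' ℤᵐ⁰) (σ' π' jK), IsDiscreteValuationRing 𝒪[K'] ∧ Finite 𝓀[K'] ∧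
  Nat.card 𝓀[K'] = q ∧ ‹hσ' hvσ' hfix' hπ' hdd' hjv hjΘ hjfix hjσ hnorm of ★ T5a VERBATIM›` from T5a's own M-letters plus `hq : #𝓀[K] = q²`, the Unr-K
  CASE-DEFINER `|ρα − Θα| < 1` (`ρΘ` residually trivial ⇔ `M ∕ K♮` unramified; its complement `|α − Θα| < 1` is type RamK), and the two transported
  E-datum clauses `hddE : |ϖE − ΘϖE| = |ϖE|^d`, `hfixE` (doubly-fixed non-zero elements have even order).  `K' := ↥{z | Θ z = z}` with the restricted
  valuation (`Valued.mk'` of `v.comap`, a local instance inside the proof only), `σ' := ρ|`, `jK :=` the inclusion, `π' :=` the uniformiser of §1; DVR by ★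
  `CartanUnique.isDiscreteValuationRing_integer`.
HONEST LABEL: HC_CM is proved only modulo the 7 printed citations (2 remaining named inputs: hLiu418 = stmt-HodgeConjecture-24832, h413 = stmt-HodgeConjecture-24833)
until rung 0 closes; (ρ2b′-X) stays an OPEN prover target; this file is a helper (`--supports`), proofs only, no registry move.

## References
* [Serre1979] J.-P. Serre, *Local Fields*, GTM 67 (1979): Ch. I §6 Prop. 18 and Ch. III §5 Thm. 3 (unramified extensions: integral basis, residue degree);
  Ch. III §4 Prop. 8, Ch. IV §1 Prop. 4 (different and transitivity in a tower — the exponent equality `𝔡(K♮ ∕ F) = 𝔡(E ∕ F)` made explicit in §1);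
  Ch. V §2 Prop. 3 and Cor. (`U_F = N(U_E)` for an unramified quadratic extension).
* [Jacobowitz1962] R. Jacobowitz, *Hermitian forms over local fields*, Amer. J. Math. 84 (1962), §4 (the three quadratic sub-extensions attached to a
  hermitian plane over a ramified quadratic extension).
* [Rogawski1990] J. D. Rogawski, *Automorphic Representations of Unitary Groups in Three Variables*, Ann. of Math. Stud. 123 (1990), §4.9 Lemma 4.9.3 p. 56
  (the eigen-field of an elliptic element with its two commuting involutions; the fixed field of the adjoint involution).
-/

set_option autoImplicit false

noncomputable section

open WithZero IsLocalRing
open scoped Valued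

namespace Summit.HodgeConjecture.HodgeConjecture.Cruxes.H413.F0P3cDyRamThirdFieldPackageUnr

variable {K : Type*} [Field K] [Valued K ℤᵐ⁰] {ρ Θ : K →+* K}

/-! ## §1 One-field currency: the auxiliary unit `α'` and the explicit `Θ`-fixed uniformiser -/

/-- **The auxiliary unit.** From `|α| ≤ 1`, `|α − ρα| = 1`, `|ρα − Θα| < 1` (ρ an isometry): some `α' ∈ {α, α + 1}` has moreover
`|α' + ρα'| = 1`. -/
theorem exists_aux_unit (hvρ : ∀ x, Valued.v (ρ x) = Valued.v x) {α : K} (hα1 : Valued.v α ≤ 1)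
    (hα : Valued.v (α - ρ α) = 1) (hτα : Valued.v (ρ α - Θ α) < 1) :
    ∃ α' : K, Valued.v α' ≤ 1 ∧ Valued.v (α' - ρ α') = 1 ∧ Valued.v (α' + ρ α') = 1 ∧ Valued.v (ρ α' - Θ α') < 1 := by
  by_cases hp : Valued.v (α + ρ α) = 1
  · exact ⟨α, hα1, hα, hp, hτα⟩
  have h2le : Valued.v (2 : K) ≤ 1 := by
    rw [show (2 : K) = 1 + 1 by norm_num]
    exact (Valuation.map_add _ _ _).trans (by rw [Valuation.map_one, max_self])
  have hple : Valued.v (α + ρ α) ≤ 1 :=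
    (Valuation.map_add _ _ _).trans (max_le hα1 ((hvρ α).le.trans hα1))
  have hplt : Valued.v (α + ρ α) < 1 := lt_of_le_of_ne hple hp
  -- `|2| = 1`: otherwise `α + ρα = (α − ρα) + 2ρα` would be a unit
  have h2 : Valued.v (2 : K) = 1 := by
    by_contra h2
    have h2lt : Valued.v (2 * ρ α) < Valued.v (α - ρ α) := by
      rw [hα, Valuation.map_mul]
      calc Valued.v (2 : K) * Valued.v (ρ α) ≤ Valued.v (2 : K) * 1 :=
            mul_le_mul_right ((hvρ α).le.trans hα1) _
        _ < 1 := by rw [mul_one]; exact lt_of_le_of_ne h2le h2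
    have : Valued.v (α + ρ α) = 1 := by
      rw [show α + ρ α = (α - ρ α) + 2 * ρ α by ring, Valuation.map_add_eq_of_lt_left _ h2lt, hα]
    exact hp this
  refine ⟨α + 1, ?_, ?_, ?_, ?_⟩
  · exact (Valuation.map_add _ _ _).trans (max_le hα1 (by rw [Valuation.map_one]))
  · rw [ρ.map_add, ρ.map_one, show α + 1 - (ρ α + 1) = α - ρ α by ring, hα]
  · rw [ρ.map_add, ρ.map_one, show α + 1 + (ρ α + 1) = 2 + (α + ρ α) by ring, Valuation.map_add_eq_of_lt_left _ (by rw [h2]; exact hplt), h2]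
  · rw [ρ.map_add, ρ.map_one, Θ.map_add, Θ.map_one, show ρ α + 1 - (Θ α + 1) = ρ α - Θ α by ring]; exact hτα

/-- **The trace of a `ρ`-fixed uniformiser drops**: if `ρP = P`, `|P| = exp(−1)` and the doubly-fixed non-zero elements have even order, then
`|P + ΘP| < |P|` (`P + ΘP` is doubly fixed of order `≥ 1`, hence `≥ 2`). -/
theorem v_add_map_lt_of_fixed (hΘΘ : ∀ x, Θ (Θ x) = x) (hΘρ : ∀ x, Θ (ρ x) = ρ (Θ x))
    (hvΘ : ∀ x, Valued.v (Θ x) = Valued.v x)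
    (hfix : ∀ z : K, ρ z = z → Θ z = z → z ≠ 0 → ∃ n : ℤ, Valued.v z = exp (2 * n))
    {P : K} (hρP : ρ P = P) (hvP : Valued.v P = exp (-1 : ℤ)) : Valued.v (P + Θ P) < Valued.v P := by
  by_cases hs : P + Θ P = 0
  · rw [hs, Valuation.map_zero, hvP]; exact zero_lt_iff.mpr WithZero.exp_ne_zero
  have hρs : ρ (P + Θ P) = P + Θ P := by rw [ρ.map_add, ← hΘρ, hρP]
  have hΘs : Θ (P + Θ P) = P + Θ P := by rw [Θ.map_add, hΘΘ, add_comm]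
  obtain ⟨n, hn⟩ := hfix _ hρs hΘs hs
  have hle : Valued.v (P + Θ P) ≤ exp (-1 : ℤ) := by
    refine (Valuation.map_add _ _ _).trans (max_le hvP.le ?_)
    rw [hvΘ, hvP]
  rw [hn, hvP, WithZero.exp_lt_exp]
  rw [hn, WithZero.exp_le_exp] at hle
  omega

/-- **THE EXPLICIT `Θ`-FIXED UNIFORMISER OF THE THIRD FIELD AND ITS `ρ`-DEPTH.**  For commuting isometric involutions `ρ, Θ`, an auxiliary unit `α'`
(`|α'| ≤ 1`, `|α' − ρα'| = |α' + ρα'| = 1`, `|ρα' − Θα'| < 1`) and a `ρ`-fixed uniformiser `P` of `Θ`-depth `d` (`|P − ΘP| = |P|^d`), with the doubly-fixed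
elements of even order: `π := (P·Θα' + ΘP·α')∕(α' + Θα')` is `Θ`-fixed, a uniformiser, and `|π − ρπ| = |π|^d` — the third field `Fix Θ` has the SAME
different exponent as `Fix ρ` (elementary form of `𝔡(K♮) = 𝔡(E)` for the biquadratic `M ⊃ E, K♮, U`). [cite: Serre1979, Ch. III §4 Prop. 8, Ch. IV §1 Prop. 4] -/
theorem exists_fixed_uniformizer (hρρ : ∀ x, ρ (ρ x) = x) (hvρ : ∀ x, Valued.v (ρ x) = Valued.v x) (hΘΘ : ∀ x, Θ (Θ x) = x)
    (hΘρ : ∀ x, Θ (ρ x) = ρ (Θ x)) (hvΘ : ∀ x, Valued.v (Θ x) = Valued.v x)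
    {α' : K} (hα'1 : Valued.v α' ≤ 1) (hm : Valued.v (α' - ρ α') = 1) (hp : Valued.v (α' + ρ α') = 1)
    (hτ : Valued.v (ρ α' - Θ α') < 1)
    {P : K} (hρP : ρ P = P) (hvP : Valued.v P = exp (-1 : ℤ)) {d : ℕ} (hdd : Valued.v (P - Θ P) = Valued.v P ^ d)
    (hfix : ∀ z : K, ρ z = z → Θ z = z → z ≠ 0 → ∃ n : ℤ, Valued.v z = exp (2 * n)) :
    ∃ π : K, Θ π = π ∧ Valued.v π = exp (-1 : ℤ) ∧ Valued.v (π - ρ π) = Valued.v π ^ d := by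
  -- the residual congruences `Θα' ≡ ρα'`, `ρΘα' ≡ α'`
  have hτ' : Valued.v (Θ α' - ρ α') < 1 := by rw [Valuation.map_sub_swap]; exact hτ
  have hτ'' : Valued.v (ρ (Θ α') - α') < 1 := by
    rw [show ρ (Θ α') - α' = ρ (Θ α' - ρ α') by rw [ρ.map_sub, hρρ], hvρ]; exact hτ'
  -- `T := α' + Θα'` is a `Θ`-fixed unit
  have hT : Valued.v (α' + Θ α') = 1 := by
    rw [show α' + Θ α' = (α' + ρ α') + (Θ α' - ρ α') by ring, Valuation.map_add_eq_of_lt_left _ (by rw [hp]; exact hτ'), hp]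
  have hT0 : α' + Θ α' ≠ 0 := fun h => by rw [h, Valuation.map_zero] at hT; exact zero_ne_one hT
  have hΘT : Θ (α' + Θ α') = α' + Θ α' := by rw [Θ.map_add, hΘΘ, add_comm]
  -- `N := P·Θα' + ΘP·α'` is `Θ`-fixed of order `|P|`
  have hΘα : Valued.v (Θ α' - α') = 1 := by
    rw [show Θ α' - α' = (ρ α' - α') + (Θ α' - ρ α') by ring, Valuation.map_add_eq_of_lt_left _ (by rw [Valuation.map_sub_swap _ (ρ α') α', hm]; exact hτ'),
      Valuation.map_sub_swap _ (ρ α') α', hm]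
  have hN : Valued.v (P * Θ α' + Θ P * α') = Valued.v P := by
    have h1 : Valued.v (P * (Θ α' - α')) = Valued.v P := by rw [Valuation.map_mul, hΘα, mul_one]
    have h2 : Valued.v ((P + Θ P) * α') < Valued.v (P * (Θ α' - α')) := by
      rw [h1, Valuation.map_mul]
      calc Valued.v (P + Θ P) * Valued.v α' ≤ Valued.v (P + Θ P) * 1 := mul_le_mul_right hα'1 _
        _ < Valued.v P := by rw [mul_one]; exact v_add_map_lt_of_fixed hΘΘ hΘρ hvΘ hfix hρP hvP
    rw [show P * Θ α' + Θ P * α' = P * (Θ α' - α') + (P + Θ P) * α' by ring, Valuation.map_add_eq_of_lt_left _ h2, h1]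
  have hΘN : Θ (P * Θ α' + Θ P * α') = P * Θ α' + Θ P * α' := by
    rw [Θ.map_add, Θ.map_mul, Θ.map_mul, hΘΘ, hΘΘ]; ring
  have hP0 : Valued.v P ≠ 0 := by rw [hvP]; exact WithZero.exp_ne_zero
  refine ⟨(P * Θ α' + Θ P * α') / (α' + Θ α'), ?_, ?_, ?_⟩
  · rw [map_div₀, hΘN, hΘT]
  · rw [map_div₀, hN, hT, div_one, hvP]
  · -- `π − ρπ = (ΘP − P)·ν ∕ (T·ρT)` with the unit `ν = α'·ρΘα' − ρα'·Θα'`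
    have hρT : Valued.v (ρ α' + ρ (Θ α')) = 1 := by rw [← ρ.map_add, hvρ, hT]
    have hρT0 : ρ α' + ρ (Θ α') ≠ 0 := fun h => by rw [h, Valuation.map_zero] at hρT; exact zero_ne_one hρT
    have hν : Valued.v (α' * ρ (Θ α') - ρ α' * Θ α') = 1 := by
      have h1 : Valued.v ((α' - ρ α') * (α' + ρ α')) = 1 := by rw [Valuation.map_mul, hm, hp, mul_one]
      have h2 : Valued.v (α' * (ρ (Θ α') - α') - ρ α' * (Θ α' - ρ α')) < 1 := by
        refine (Valuation.map_sub _ _ _).trans_lt (max_lt ?_ ?_)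
        · rw [Valuation.map_mul]
          calc Valued.v α' * Valued.v (ρ (Θ α') - α') ≤ 1 * Valued.v (ρ (Θ α') - α') := mul_le_mul_left hα'1 _
            _ < 1 := by rw [one_mul]; exact hτ''
        · rw [Valuation.map_mul, hvρ]
          calc Valued.v α' * Valued.v (Θ α' - ρ α') ≤ 1 * Valued.v (Θ α' - ρ α') := mul_le_mul_left hα'1 _
            _ < 1 := by rw [one_mul]; exact hτ'
      rw [show α' * ρ (Θ α') - ρ α' * Θ α' = (α' - ρ α') * (α' + ρ α') + (α' * (ρ (Θ α') - α') - ρ α' * (Θ α' - ρ α')) by ring,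
        Valuation.map_add_eq_of_lt_left _ (by rw [h1]; exact h2), h1]
    have hkey : (P * Θ α' + Θ P * α') / (α' + Θ α') - ρ ((P * Θ α' + Θ P * α') / (α' + Θ α')) =
        (Θ P - P) * (α' * ρ (Θ α') - ρ α' * Θ α') / ((α' + Θ α') * (ρ α' + ρ (Θ α'))) := by
      have hρΘP : ρ (Θ P) = Θ P := by rw [← hΘρ, hρP]
      rw [map_div₀, ρ.map_add, ρ.map_add, ρ.map_mul, ρ.map_mul, hρP, hρΘP, div_sub_div _ _ hT0 hρT0]
      congr 1; ring
    rw [hkey, map_div₀, Valuation.map_mul, Valuation.map_mul, hν, hT, hρT, mul_one, mul_one, div_one, Valuation.map_sub_swap, hdd,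
      map_div₀, hN, hT, div_one]

/-! ## §2 One-field currency: Θ-fixed units are Θ-norms of units (`M ∕ K♮` unramified, Serre V §2) -/

/-- `x ∈ 𝒪[K]` is a unit iff `|x| = 1`. -/
theorem isUnit_iff_v_eq_one (x : 𝒪[K]) : IsUnit x ↔ Valued.v (x : K) = 1 :=
  Valuation.Integers.isUnit_iff_valuation_eq_one (Valuation.integer.integers _)

/-- **A `Θ`-FIXED UNIT IS A `Θ`-NORM OF A UNIT** (`U_{K♮} = N(U_M)` for the unramified `M ∕ K♮`): for an isometric involution `Θ` of the complete `K` with finite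
residue field which moves some integer `α'` by a unit (`|Θα' − α'| = 1`), every `Θ`-fixed `z` with `|z| = 1` is `ω·Θω` with `|ω| = 1` (★ Serre V §2
`exists_mul_map_eq_of_finite_residueField` on `𝒪[K]`, which is `𝓂`-adically complete by ★ `isAdicComplete_valuedInteger_of_completeSpace`).
[cite: Serre1979, Ch. V §2 Prop. 3 and Cor.] -/
theorem exists_unit_mul_map_eq [CompleteSpace K] [Finite 𝓀[K]] (hΘΘ : ∀ x, Θ (Θ x) = x) (hvΘ : ∀ x, Valued.v (Θ x) = Valued.v x)
    {α' : K} (hα'1 : Valued.v α' ≤ 1) (hΘα : Valued.v (Θ α' - α') = 1) {P : K} (hvP : Valued.v P = exp (-1 : ℤ))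
    (z : Kˣ) (hΘz : Θ (z : K) = z) (hvz : Valued.v (z : K) = 1) :
    ∃ ω : Kˣ, Valued.v (ω : K) = 1 ∧ (ω : K) * Θ ω = z := by
  haveI : IsAdicComplete 𝓂[K] 𝒪[K] := Literature.NumberTheory.LocalFields.isAdicComplete_valuedInteger_of_completeSpace hvP
  have hΘO : ∀ y : 𝒪[K], (Θ.comp 𝒪[K].subtype) y ∈ 𝒪[K] := fun y =>
    (Valuation.mem_integer_iff _ _).2 (by rw [RingHom.comp_apply, hvΘ]; exact y.2)
  set ΘO : 𝒪[K] →+* 𝒪[K] := (Θ.comp 𝒪[K].subtype).codRestrict 𝒪[K] hΘO with hΘOdef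
  have hΘOO : ∀ y, ΘO (ΘO y) = y := fun y => Subtype.ext (hΘΘ (y : K))
  let a : 𝒪[K] := ⟨α', (Valuation.mem_integer_iff _ _).2 hα'1⟩
  have ha : IsUnit (ΘO a - a) := (isUnit_iff_v_eq_one _).2 hΘα
  let u : 𝒪[K] := ⟨(z : K), (Valuation.mem_integer_iff _ _).2 hvz.le⟩
  have hu : IsUnit u := (isUnit_iff_v_eq_one _).2 hvz
  have hΘu : ΘO u = u := Subtype.ext hΘz
  obtain ⟨s, hs⟩ := Literature.NumberTheory.LocalFields.UnramifiedQuadraticNorm.exists_mul_map_eq_of_finite_residueField ΘO hΘOO ha u hu hΘu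
  have hs' : (s : K) * Θ (s : K) = z := congrArg Subtype.val hs
  have hs1 : Valued.v (s : K) ≤ 1 := (Valuation.mem_integer_iff _ _).1 s.2
  have hvs : Valued.v (s : K) = 1 := by
    refine le_antisymm hs1 ?_
    have h := congrArg Valued.v hs'
    rw [Valuation.map_mul, hvΘ, hvz] at h
    calc (1 : ℤᵐ⁰) = Valued.v (s : K) * Valued.v (s : K) := h.symm
      _ ≤ Valued.v (s : K) * 1 := mul_le_mul_right hs1 _
      _ = Valued.v (s : K) := mul_one _
  have hs0 : (s : K) ≠ 0 := fun h => by rw [h, Valuation.map_zero] at hvs; exact zero_ne_one hvs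
  exact ⟨Units.mk0 (s : K) hs0, hvs, hs'⟩

/-! ## §3 An abstract third field: a valued field `K'` isometrically embedded onto `Fix Θ` — residue fields -/

section Abstract

variable {K' : Type*} [Field K'] [Valued K' ℤᵐ⁰]

/-- Coordinates on `(1, α)` detect the order: for `Θ`-fixed `s, t` (images of `K'`), `|s + t·α| < 1 ⇒ |t| < 1 ∧ |s| < 1` when `|α| ≤ 1`, `|Θα − α| = 1`. -/
theorem v_lt_one_of_v_add_mul_lt_one (hvΘ : ∀ x, Valued.v (Θ x) = Valued.v x) {α : K} (hα1 : Valued.v α ≤ 1)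
    (hΘα : Valued.v (Θ α - α) = 1) {s t : K} (hs : Θ s = s) (ht : Θ t = t) (h : Valued.v (s + t * α) < 1) :
    Valued.v t < 1 ∧ Valued.v s < 1 := by
  have hkey : t * (α - Θ α) = (s + t * α) - Θ (s + t * α) := by rw [Θ.map_add, Θ.map_mul, hs, ht]; ring
  have hvt : Valued.v t < 1 := by
    have h1 : Valued.v (t * (α - Θ α)) < 1 := by
      rw [hkey]
      exact (Valuation.map_sub _ _ _).trans_lt (max_lt h (by rw [hvΘ]; exact h))
    rwa [Valuation.map_mul, Valuation.map_sub_swap, hΘα, mul_one] at h1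
  refine ⟨hvt, ?_⟩
  rw [show s = (s + t * α) - t * α by ring]
  refine (Valuation.map_sub _ _ _).trans_lt (max_lt h ?_)
  rw [Valuation.map_mul]
  calc Valued.v t * Valued.v α ≤ Valued.v t * 1 := mul_le_mul_right hα1 _
    _ < 1 := by rw [mul_one]; exact hvt

/-- **THE RESIDUE FIELD OF `M` IS QUADRATIC OVER THAT OF THE THIRD FIELD**: if `K'` embeds isometrically into `K` onto the fixed field of the isometric
involution `Θ`, and `Θ` moves some integer `α` by a unit, then `𝓀[K']` is finite with `#𝓀[K] = #𝓀[K']²` — the integral basis `z = x + y·α`,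
`y = (z − Θz)∕(α − Θα)`, of `𝒪_M` over `𝒪_{K♮}` (`M ∕ K♮` unramified). [cite: Serre1979, Ch. I §6 Prop. 18, Ch. III §5 Thm. 3] -/
theorem finite_and_natCard_residueField_eq_sq [Finite 𝓀[K]] (hΘΘ : ∀ x, Θ (Θ x) = x) (hvΘ : ∀ x, Valued.v (Θ x) = Valued.v x)
    (jK : K' →+* K) (hjv : ∀ x, Valued.v (jK x) = Valued.v x) (hjΘ : ∀ x, Θ (jK x) = jK x)
    (hjfix : ∀ z : K, Θ z = z → ∃ x, jK x = z) {α : K} (hα1 : Valued.v α ≤ 1) (hΘα : Valued.v (Θ α - α) = 1) :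
    Finite 𝓀[K'] ∧ Nat.card 𝓀[K] = Nat.card 𝓀[K'] ^ 2 := by
  classical
  -- the integral embedding and its residue map
  have hjO : ∀ x : 𝒪[K'], (jK.comp 𝒪[K'].subtype) x ∈ 𝒪[K] := fun x =>
    (Valuation.mem_integer_iff _ _).2 (by rw [RingHom.comp_apply, hjv]; exact x.2)
  set jO : 𝒪[K'] →+* 𝒪[K] := (jK.comp 𝒪[K'].subtype).codRestrict 𝒪[K] hjO with hjOdef
  have hjOv : ∀ x : 𝒪[K'], Valued.v ((jO x : 𝒪[K]) : K) = Valued.v (x : K') := fun x => hjv x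
  haveI : IsLocalHom jO := ⟨fun x hx => by
    rw [isUnit_iff_v_eq_one] at hx ⊢
    rwa [hjOv] at hx⟩
  set r : 𝓀[K'] →+* 𝓀[K] := IsLocalRing.ResidueField.map jO with hrdef
  have hr : Function.Injective r := r.injective
  haveI hfin : Finite 𝓀[K'] := Finite.of_injective r hr
  refine ⟨hfin, ?_⟩
  -- the map `(a, b) ↦ a + b·ᾱ`
  let αO : 𝒪[K] := ⟨α, (Valuation.mem_integer_iff _ _).2 hα1⟩
  let Φ : 𝓀[K'] × 𝓀[K'] → 𝓀[K] := fun p => r p.1 + r p.2 * IsLocalRing.residue 𝒪[K] αO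
  have hα0 : α - Θ α ≠ 0 := fun h => by
    rw [Valuation.map_sub_swap, h, Valuation.map_zero] at hΘα; exact zero_ne_one hΘα
  have hΦ : Function.Bijective Φ := by
    constructor
    · rintro ⟨a, b⟩ ⟨a', b'⟩ hab
      obtain ⟨xa, rfl⟩ := IsLocalRing.residue_surjective a
      obtain ⟨xb, rfl⟩ := IsLocalRing.residue_surjective b
      obtain ⟨xa', rfl⟩ := IsLocalRing.residue_surjective a'
      obtain ⟨xb', rfl⟩ := IsLocalRing.residue_surjective b'
      have hab' : IsLocalRing.residue 𝒪[K] (jO xa + jO xb * αO) = IsLocalRing.residue 𝒪[K] (jO xa' + jO xb' * αO) := by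
        simpa only [Φ, hrdef, IsLocalRing.ResidueField.map_residue, map_add, map_mul] using hab
      rw [← sub_eq_zero, ← map_sub, IsLocalRing.residue_eq_zero_iff, IsLocalRing.mem_maximalIdeal, mem_nonunits_iff,
        Valuation.Integer.not_isUnit_iff_valuation_lt_one] at hab'
      have hlt : Valued.v (jK ((xa : K') - xa') + jK ((xb : K') - xb') * α) < 1 := by
        have hcoe : ((jO xa + jO xb * αO - (jO xa' + jO xb' * αO) : 𝒪[K]) : K) = jK ((xa : K') - xa') + jK ((xb : K') - xb') * α := by
          rw [map_sub, map_sub]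
          change jK xa + jK xb * α - (jK xa' + jK xb' * α) = _
          ring
        rw [← hcoe]; exact hab'
      obtain ⟨hb, ha⟩ := v_lt_one_of_v_add_mul_lt_one hvΘ hα1 hΘα (hjΘ _) (hjΘ _) hlt
      rw [hjv] at ha hb
      have ha' : IsLocalRing.residue 𝒪[K'] xa = IsLocalRing.residue 𝒪[K'] xa' := by
        rw [← sub_eq_zero, ← map_sub, IsLocalRing.residue_eq_zero_iff, IsLocalRing.mem_maximalIdeal, mem_nonunits_iff,
        Valuation.Integer.not_isUnit_iff_valuation_lt_one]; exact ha
      have hb' : IsLocalRing.residue 𝒪[K'] xb = IsLocalRing.residue 𝒪[K'] xb' := by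
        rw [← sub_eq_zero, ← map_sub, IsLocalRing.residue_eq_zero_iff, IsLocalRing.mem_maximalIdeal, mem_nonunits_iff,
        Valuation.Integer.not_isUnit_iff_valuation_lt_one]; exact hb
      rw [ha', hb']
    · intro c
      obtain ⟨z, rfl⟩ := IsLocalRing.residue_surjective c
      -- `z = x₀ + y₀ α` with `x₀, y₀` fixed by `Θ`
      set y₀ : K := ((z : K) - Θ z) / (α - Θ α) with hy₀
      have hΘy₀ : Θ y₀ = y₀ := by
        rw [hy₀, map_div₀, Θ.map_sub, Θ.map_sub, hΘΘ, hΘΘ, ← neg_sub (z : K), ← neg_sub α, neg_div_neg_eq]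
      set x₀ : K := (z : K) - y₀ * α with hx₀
      have hΘx₀ : Θ x₀ = x₀ := by
        have : x₀ - Θ x₀ = ((z : K) - Θ z) - y₀ * (α - Θ α) := by rw [hx₀, Θ.map_sub, Θ.map_mul, hΘy₀]; ring
        rw [hy₀, div_mul_cancel₀ _ hα0, sub_self, sub_eq_zero] at this
        exact this.symm
      obtain ⟨y, hy⟩ := hjfix y₀ hΘy₀
      obtain ⟨x, hx⟩ := hjfix x₀ hΘx₀
      have hz1 : Valued.v (z : K) ≤ 1 := (Valuation.mem_integer_iff _ _).1 z.2
      have hvy : Valued.v y ≤ 1 := by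
        rw [← hjv, hy, hy₀, map_div₀, Valuation.map_sub_swap _ α, hΘα, div_one]
        exact (Valuation.map_sub _ _ _).trans (max_le hz1 (by rw [hvΘ]; exact hz1))
      have hvx : Valued.v x ≤ 1 := by
        rw [← hjv, hx, hx₀]
        refine (Valuation.map_sub _ _ _).trans (max_le hz1 ?_)
        rw [Valuation.map_mul, ← hy, hjv]
        calc Valued.v y * Valued.v α ≤ 1 * 1 := mul_le_mul' hvy hα1
          _ = 1 := mul_one _
      refine ⟨(IsLocalRing.residue 𝒪[K'] ⟨x, (Valuation.mem_integer_iff _ _).2 hvx⟩,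
        IsLocalRing.residue 𝒪[K'] ⟨y, (Valuation.mem_integer_iff _ _).2 hvy⟩), ?_⟩
      simp only [Φ, hrdef, IsLocalRing.ResidueField.map_residue, ← map_mul, ← map_add]
      congr 1
      apply Subtype.ext
      change jK x + jK y * α = (z : K)
      rw [hx, hy, hx₀]; ring
  rw [← Nat.card_eq_of_bijective Φ hΦ, Nat.card_prod, sq]

end Abstract

/-! ## §4 THE THIRD-FIELD PACKAGE at type U (the dealt S2′ head: every `K'`-binder of ★ T5a `ncard_levelSet_unr_hyper`) -/

/-- **S2′ — THE THIRD-FIELD PACKAGE, TYPE U (`M ∕ E` and `M ∕ K♮` unramified).**  In the one-field currency of the frame — `K` a model of `M` (complete,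
`𝒪` a DVR, residue field of size `q²`), `ρ = Gal(M ∕ E)` and `Θ` commuting isometric involutions, `α` integral with `|α − ρα| = 1` (M ∕ E unramified),
the Unr-K case-definer `|ρα − Θα| < 1` (`ρΘ` residually trivial ⇔ `M ∕ K♮` unramified), a `ρ`-fixed uniformiser `ϖE` of `Θ`-depth `d ≥ 1`
(`|ϖE − ΘϖE| = |ϖE|^d`, the E-datum transported along `ι_E`) and the even-order clause for doubly-fixed elements (the `F`-elements) — THE THIRD FIELD
`K♮ = Fix Θ` IS A VALUED FIELD `K'` IN ITS OWN RIGHT with: `𝒪[K']` a DVR, `#𝓀[K'] = q`, the involution `σ' = ρ|_{K♮}` isometric with the `σ'`-fixed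
non-zero elements of even order, a uniformiser `π'` with `|π' − σ'π'| = |π'|^d` (SAME `d`), the isometric embedding `jK : K' →+* K` onto `Fix Θ`
intertwining `σ'` and `ρ`, and the unit-norm surjectivity of `M ∕ K♮` — i.e. the binders `hσ' hvσ' hfix' hπ' hdd' hq' jK hjv hjΘ hjfix hjσ hnorm` and both
instances of ★ T5a `F0P3cDyRamToricLevelCensusUnr.ncard_levelSet_unr_hyper`, VERBATIM.  (`K' := ↥{z | Θ z = z}` with the restricted valuation;
`π' := (ϖE·Θα' + ΘϖE·α')∕(α' + Θα')`, §1.) [cite: Serre1979, Ch. III §5 Thm. 3, Ch. V §2 Prop. 3] [cite: Jacobowitz1962, §4] -/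
theorem exists_thirdFieldPackage_unr {K : Type} [Field K] [Valued K ℤᵐ⁰] [CompleteSpace K]
    [IsDiscreteValuationRing 𝒪[K]] [Finite 𝓀[K]] {q : ℕ} (hq : Nat.card 𝓀[K] = q ^ 2)
    {ρ Θ : K →+* K} (hρρ : ∀ x, ρ (ρ x) = x) (hvρ : ∀ x, Valued.v (ρ x) = Valued.v x) (hΘΘ : ∀ x, Θ (Θ x) = x)
    (hΘρ : ∀ x, Θ (ρ x) = ρ (Θ x)) (hvΘ : ∀ x, Valued.v (Θ x) = Valued.v x)
    {α : K} (hα1 : Valued.v α ≤ 1) (hα : Valued.v (α - ρ α) = 1) (hτα : Valued.v (ρ α - Θ α) < 1)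
    {ϖE : K} (hρϖE : ρ ϖE = ϖE) (hϖE : Valued.v ϖE = exp (-1 : ℤ)) {d : ℕ} (hddE : Valued.v (ϖE - Θ ϖE) = Valued.v ϖE ^ d)
    (hfixE : ∀ z : K, ρ z = z → Θ z = z → z ≠ 0 → ∃ n : ℤ, Valued.v z = exp (2 * n)) :
    ∃ (K' : Type) (_ : Field K') (_ : Valued K' ℤᵐ⁰) (σ' : K' →+* K') (π' : K') (jK : K' →+* K),
      IsDiscreteValuationRing 𝒪[K'] ∧ Finite 𝓀[K'] ∧ Nat.card 𝓀[K'] = q ∧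
      (∀ x, σ' (σ' x) = x) ∧ (∀ x, Valued.v (σ' x) = Valued.v x) ∧
      (∀ x : K', σ' x = x → x ≠ 0 → ∃ n : ℤ, Valued.v x = exp (2 * n)) ∧
      Valued.v π' = exp (-1 : ℤ) ∧ Valued.v (π' - σ' π') = Valued.v π' ^ d ∧
      (∀ x, Valued.v (jK x) = Valued.v x) ∧ (∀ x, Θ (jK x) = jK x) ∧
      (∀ z : K, Θ z = z → ∃ x, jK x = z) ∧ (∀ x, jK (σ' x) = ρ (jK x)) ∧
      (∀ z : Kˣ, Θ (z : K) = z → Valued.v (z : K) = 1 → ∃ ω : Kˣ, Valued.v (ω : K) = 1 ∧ (ω : K) * Θ ω = z) := by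
  -- the auxiliary unit and the explicit `Θ`-fixed uniformiser (§1)
  obtain ⟨α', hα'1, hm, hp, hτ⟩ := exists_aux_unit hvρ hα1 hα hτα
  have hΘα' : Valued.v (Θ α' - α') = 1 := by
    have hτ' : Valued.v (Θ α' - ρ α') < 1 := by rw [Valuation.map_sub_swap]; exact hτ
    rw [show Θ α' - α' = (ρ α' - α') + (Θ α' - ρ α') by ring, Valuation.map_add_eq_of_lt_left _ (by rw [Valuation.map_sub_swap _ (ρ α') α', hm]; exact hτ'),
      Valuation.map_sub_swap _ (ρ α') α', hm]
  obtain ⟨π, hΘπ, hvπ, hπρ⟩ := exists_fixed_uniformizer hρρ hvρ hΘΘ hΘρ hvΘ hα'1 hm hp hτ hρϖE hϖE hddE hfixE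
  -- the fixed field of `Θ`, valued by restriction
  let S : Subfield K :=
    { carrier := {z | Θ z = z}
      mul_mem' := fun {a b} ha hb => by
        simp only [Set.mem_setOf_eq] at ha hb ⊢; rw [Θ.map_mul, ha, hb]
      one_mem' := Θ.map_one
      add_mem' := fun {a b} ha hb => by
        simp only [Set.mem_setOf_eq] at ha hb ⊢; rw [Θ.map_add, ha, hb]
      zero_mem' := Θ.map_zero
      neg_mem' := fun {a} ha => by
        simp only [Set.mem_setOf_eq] at ha ⊢; rw [Θ.map_neg, ha]
      inv_mem' := fun a ha => by
        simp only [Set.mem_setOf_eq] at ha ⊢; rw [map_inv₀, ha] }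
  letI : Valued S ℤᵐ⁰ := Valued.mk' (Valued.v.comap S.subtype)
  have hρS : ∀ x : S, (ρ.comp S.subtype) x ∈ S := fun x => by
    show Θ (ρ x) = ρ x
    rw [hΘρ, show Θ (x : K) = x from x.2]
  let σ' : S →+* S := (ρ.comp S.subtype).codRestrict S hρS
  obtain ⟨hfin, hcard⟩ := finite_and_natCard_residueField_eq_sq (K' := S) hΘΘ hvΘ S.subtype (fun _ => rfl) (fun x => x.2)
    (fun z hz => ⟨⟨z, hz⟩, rfl⟩) hα'1 hΘα'
  refine ⟨S, inferInstance, inferInstance, σ', ⟨π, hΘπ⟩, S.subtype,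
    Literature.NumberTheory.Automorphic.CartanUnique.isDiscreteValuationRing_integer (K := S) (ϖ := ⟨π, hΘπ⟩) hvπ, hfin, ?_,
    fun x => Subtype.ext (hρρ (x : K)), fun x => hvρ (x : K), ?_, hvπ, hπρ, fun _ => rfl, fun x => x.2, fun z hz => ⟨⟨z, hz⟩, rfl⟩,
    fun _ => rfl, exists_unit_mul_map_eq hΘΘ hvΘ hα'1 hΘα' hϖE⟩
  · rw [hq] at hcard
    exact (Nat.pow_left_injective two_ne_zero hcard).symm
  · intro x hx h0
    exact hfixE (x : K) (congrArg Subtype.val hx) x.2 (fun h => h0 (Subtype.ext h))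

end Summit.HodgeConjecture.HodgeConjecture.Cruxes.H413.F0P3cDyRamThirdFieldPackageUnr

end
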